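import Summits.AtomisticToContinuum.FouriersLaw.Theorems.HonestZwanzigOrthogonalOhmDirichletBound
import Summits.AtomisticToContinuum.FouriersLaw.Theorems.OddSectorIrreversibilityOddDensityIsCorrectorAdjoint
import Summits.AtomisticToContinuum.FouriersLaw.Theorems.BondHeatUncertaintySubdiffusiveBondHeatSiteEnergyDynkinTruncation

/-!
# Stub `stub_pencilOfGreenKubo` of line `cayley-pencil` (crux `ContactStieltjesMeasure.StieltjesRepresentation`,
# stmt-AtomisticToContinuum-15248), part 4a: the cross-friction CUTOFF identity of two Poisson solutions

Helper file (`--supports stmt-AtomisticToContinuum-15248`). Pinned anharmonic chain `P_γ = pinnedChain ω₂ lam β γ`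
(`ω₂ > 0`, `lam, β ≥ 0`), `N ≥ 2`, both baths at `T > 0`, Gibbs weight `ρ = e^{-H/T}` (independent of `γ`), generators
`L_γ = P_γ.generator N T T` at TWO frictions `γ ≥ 0` and `γ₁`, and the momentum flip `Θ(q,p) = (q,-p)`, so that
`L_γ† k := (L_γ(k∘Θ))∘Θ` is the formal `L²(μ_T)`-adjoint of `L_γ` (`integral_generator_mul_eq_reversal`).

* `generator_eq_generator_add` — the generator is affine in the friction:
  `L_γ f = L_{γ₁} f + (γ - γ₁) Σ_{b ∈ {0,N-1}} (T∂²_{p_b} f - p_b ∂_{p_b} f)`.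
* `cross_cutoff_identity` — for smooth `w, w'`, continuous `v, v'` with `L_{γ₁} w = -v` and `L_γ† w' = -v'` pointwise and
  the energy cutoff `χ = χ(H/R)`: the EXACT identity
  `∫ χ w v' ρ = ∫ χ v w' ρ + (γ-γ₁)T Σ_b (∫ χ ∂_b w' ∂_b w ρ + ∫ w' ∂_bχ ∂_b w ρ) - ∫ w M_R w' ρ - 2γT Σ_b ∫ ∂_bχ ∂_b w w' ρ`
  (test `L_γ(wχ)` against `w'`: adjointness with compact support, the product rule
  `generator_mul_smoothCutoff_hamiltonian`, the friction shift, and the carré du champ of the Ornstein–Uhlenbeck taps —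
  the second-order bath operator only ever meets the compactly supported factor `w'χ`).
The limit `R → ∞` (`cross_pairing`) is part 4b. No definitions.
-/

noncomputable section

open MeasureTheory Filter Topology Set Function
open scoped ContDiff
open Literature.MathematicalPhysics.KineticTheory.HeatConduction

namespace Summit.AtomisticToContinuum.FouriersLaw.Theorems.ContactStieltjesMeasure.CayleyPencil

namespace Pencil

open Summit.AtomisticToContinuum.FouriersLaw.Theorems.OddSectorIrreversibility
  (integral_bath_mul_gibbsDensity_eq_neg sum_ite_ends_eq integral_bath_mul_mul_gibbsDensity
    integral_generator_mul_eq_reversal contDiff_energyCutoff hasCompactSupport_energyCutoff partialP_energyCutoff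
    partialP_mul tendsto_energyCutoff_atTop)
open Summit.AtomisticToContinuum.FouriersLaw.Theorems.HonestZwanzig.OrthogonalOhmLine.DirichletBound
  (abs_partialP_energyCutoff_le abs_cross_le_amgm integrable_weights)
open Summit.AtomisticToContinuum.FouriersLaw.Theorems.SubdiffusiveBondHeat
  (exists_bound_deriv_smoothCutoff exists_bound_deriv_deriv_smoothCutoff generator_mul_smoothCutoff_hamiltonian)

variable {N : ℕ}

/-! ### The generator is affine in the friction -/

/-- **Friction shift**: `L_γ f = L_{γ₁} f + (γ - γ₁)·Σ_{b∈{0,N-1}} (T∂²_{p_b}f - p_b∂_{p_b}f)` (`N ≥ 2`; the Liouville part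
and the Gibbs data do not depend on the friction). [folklore] -/
theorem generator_eq_generator_add (ω₂ lam β γ γ₁ : ℝ) (hN : 2 ≤ N) (T : ℝ) (f : PhaseSpace N → ℝ)
    (x : PhaseSpace N) :
    (pinnedChain ω₂ lam β γ).generator N T T f x = (pinnedChain ω₂ lam β γ₁).generator N T T f x +
      (γ - γ₁) * ((T * partialP ⟨0, by omega⟩ (partialP ⟨0, by omega⟩ f) x -
          x.2 ⟨0, by omega⟩ * partialP ⟨0, by omega⟩ f x) +
        (T * partialP ⟨N - 1, by omega⟩ (partialP ⟨N - 1, by omega⟩ f) x -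
          x.2 ⟨N - 1, by omega⟩ * partialP ⟨N - 1, by omega⟩ f x)) := by
  have hH : (pinnedChain ω₂ lam β γ).hamiltonian N = (pinnedChain ω₂ lam β γ₁).hamiltonian N := rfl
  have hγ : (pinnedChain ω₂ lam β γ).γ = γ := rfl
  have hγ₁ : (pinnedChain ω₂ lam β γ₁).γ = γ₁ := rfl
  simp only [OscillatorChain.generator, hH, hγ, hγ₁]
  rw [sum_ite_ends_eq hN]
  ring

section Pinned

variable {ω₂ lam β : ℝ} (hω : 0 < ω₂) (hl : 0 ≤ lam) (hβ : 0 ≤ β) (hN : 2 ≤ N) {T : ℝ} (hT : 0 < T)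
include hω hl hβ hN hT

/-! ### The cutoff identity -/

/-- **The cross-friction cutoff identity.** For `γ ≥ 0`, `γ₁ ∈ ℝ`, smooth `w, w'`, continuous `v, v'` with
`L_{γ₁} w = -v` and `L_γ† w' = -v'` (`L_γ† k = (L_γ(k∘Θ))∘Θ`) pointwise, `R > 0` and `χ = χ(H/R)`:
`∫ χwv'ρ = ∫ χvw'ρ + (γ-γ₁)T Σ_b (∫ χ∂_bw'∂_bwρ + ∫ w'∂_bχ∂_bwρ) - ∫ wM_Rw'ρ - 2γT Σ_b ∫ ∂_bχ∂_bw w'ρ`, with the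
multiplier `M_R = γ(χ'(H/R)/R·(2T - p_0² - p_{N-1}²) + χ''(H/R)/R²·T(p_0² + p_{N-1}²))` of the product rule. [folklore] -/
theorem cross_cutoff_identity {γ : ℝ} (hγ : 0 ≤ γ) (γ₁ : ℝ) {w v w' v' : PhaseSpace N → ℝ} (hw : ContDiff ℝ ∞ w)
    (hw' : ContDiff ℝ ∞ w') (hvc : Continuous v)
    (hLw : ∀ x, (pinnedChain ω₂ lam β γ₁).generator N T T w x = -v x)
    (hLw' : ∀ x, (pinnedChain ω₂ lam β γ).generator N T T (fun y : PhaseSpace N => w' (y.1, -y.2)) (x.1, -x.2) =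
      -v' x)
    {R : ℝ} (hR : 0 < R) {χ : PhaseSpace N → ℝ}
    (hχ : ∀ x, χ x = smoothCutoff ((pinnedChain ω₂ lam β γ).hamiltonian N x / R)) :
    ∫ x, χ x * w x * v' x * (pinnedChain ω₂ lam β γ).gibbsDensity N T x =
      (∫ x, χ x * v x * w' x * (pinnedChain ω₂ lam β γ).gibbsDensity N T x) +
      (γ - γ₁) * T *
        (((∫ x, χ x * partialP ⟨0, by omega⟩ w' x * partialP ⟨0, by omega⟩ w x *
              (pinnedChain ω₂ lam β γ).gibbsDensity N T x) +
            ∫ x, w' x * partialP ⟨0, by omega⟩ χ x * partialP ⟨0, by omega⟩ w x *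
              (pinnedChain ω₂ lam β γ).gibbsDensity N T x) +
          ((∫ x, χ x * partialP ⟨N - 1, by omega⟩ w' x * partialP ⟨N - 1, by omega⟩ w x *
              (pinnedChain ω₂ lam β γ).gibbsDensity N T x) +
            ∫ x, w' x * partialP ⟨N - 1, by omega⟩ χ x * partialP ⟨N - 1, by omega⟩ w x *
              (pinnedChain ω₂ lam β γ).gibbsDensity N T x)) -
      (∫ x, w x * (γ * (deriv smoothCutoff ((pinnedChain ω₂ lam β γ).hamiltonian N x / R) / R *
            (T + T - x.2 ⟨0, by omega⟩ ^ 2 - x.2 ⟨N - 1, by omega⟩ ^ 2) +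
          deriv (deriv smoothCutoff) ((pinnedChain ω₂ lam β γ).hamiltonian N x / R) / R ^ 2 *
            (T * x.2 ⟨0, by omega⟩ ^ 2 + T * x.2 ⟨N - 1, by omega⟩ ^ 2))) * w' x *
          (pinnedChain ω₂ lam β γ).gibbsDensity N T x) -
      2 * γ * T *
        ((∫ x, partialP ⟨0, by omega⟩ χ x * partialP ⟨0, by omega⟩ w x * w' x *
            (pinnedChain ω₂ lam β γ).gibbsDensity N T x) +
          ∫ x, partialP ⟨N - 1, by omega⟩ χ x * partialP ⟨N - 1, by omega⟩ w x * w' x *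
            (pinnedChain ω₂ lam β γ).gibbsDensity N T x) := by
  set P := pinnedChain ω₂ lam β γ with hP
  set ρ := P.gibbsDensity N T with hρ
  set H := P.hamiltonian N with hH
  set b₀ : Fin N := ⟨0, by omega⟩ with hb₀
  set b₁ : Fin N := ⟨N - 1, by omega⟩ with hb₁
  have hN0 : 0 < N := by omega
  have hU : ContDiff ℝ ∞ P.U := pinnedChain_contDiff_U ω₂ lam β γ
  have hV : ContDiff ℝ ∞ P.V := pinnedChain_contDiff_V ω₂ lam β γ
  have hU1 : ContDiff ℝ 1 P.U := pinnedChain_contDiff_U ω₂ lam β γ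
  have hV1 : ContDiff ℝ 1 P.V := pinnedChain_contDiff_V ω₂ lam β γ
  have hU2 : ContDiff ℝ 2 P.U := pinnedChain_contDiff_U ω₂ lam β γ
  have hV2 : ContDiff ℝ 2 P.V := pinnedChain_contDiff_V ω₂ lam β γ
  have hγ' : P.γ = γ := rfl
  have hγT : 0 ≤ P.γ * T := by rw [hγ']; positivity
  have hρc : Continuous ρ := pinnedChain_continuous_gibbsDensity ω₂ lam β γ N T
  have hHc : Continuous H := pinnedChain_continuous_hamiltonian ω₂ lam β γ N
  have hχf : χ = fun x => smoothCutoff (H x / R) := funext hχ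
  have hχs : ContDiff ℝ ∞ χ := by rw [hχf]; exact contDiff_energyCutoff (ω₂ := ω₂) (lam := lam) (β := β) γ N R
  have hχc : HasCompactSupport χ := by rw [hχf]; exact hasCompactSupport_energyCutoff hω hl hβ γ N hR
  have hχ2 : ContDiff ℝ 2 χ := hχs.of_le (by norm_cast)
  have hw2 : ContDiff ℝ 2 w := hw.of_le (by norm_cast)
  have hw'2 : ContDiff ℝ 2 w' := hw'.of_le (by norm_cast)
  have hw1 : ContDiff ℝ 1 w := hw.of_le (by norm_cast)
  have hw'1 : ContDiff ℝ 1 w' := hw'.of_le (by norm_cast)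
  have hwd : Differentiable ℝ w := hw1.differentiable one_ne_zero
  have hw'd : Differentiable ℝ w' := hw'1.differentiable one_ne_zero
  have hχd : Differentiable ℝ χ := hχ2.differentiable (by norm_num)
  have hχcont : Continuous χ := hχs.continuous
  have hPwc : ∀ i, Continuous (partialP i w) := fun i => continuous_partialP hw (by simp) i
  have hPw'c : ∀ i, Continuous (partialP i w') := fun i => continuous_partialP hw' (by simp) i
  have hPPwc : ∀ i, Continuous (partialP i (partialP i w)) := fun i =>
    continuous_partialP (contDiff_partialP hw (m := 1) (by norm_cast) i) one_ne_zero i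
  have hPχc : ∀ i, Continuous (partialP i χ) := fun i => continuous_partialP hχs (by simp) i
  have hpc : ∀ i : Fin N, Continuous fun x : PhaseSpace N => x.2 i := fun i =>
    (continuous_apply i).comp continuous_snd
  have hdχc : Continuous fun x => deriv smoothCutoff (H x / R) :=
    ((contDiff_smoothCutoff (n := 1)).continuous_deriv le_rfl).comp (hHc.div_const R)
  have hddχc : Continuous fun x => deriv (deriv smoothCutoff) (H x / R) :=
    (((contDiff_smoothCutoff (n := 2)).deriv').continuous_deriv le_rfl).comp (hHc.div_const R)
  -- the test function `F = w χ ∈ C²_c` and adjointness: `∫ (L_γ F) w' ρ = -∫ F v' ρ`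
  set F : PhaseSpace N → ℝ := fun y => w y * χ y with hF
  have hF2 : ContDiff ℝ 2 F := hw2.mul hχ2
  have hFc : HasCompactSupport F := hχc.mul_left
  have hadj := integral_generator_mul_eq_reversal P hU1 hV1 N T hT.ne' hF2 hFc hw'2
  have e0 : ∫ x, F x * P.generator N T T (fun y : PhaseSpace N => w' (y.1, -y.2)) (x.1, -x.2) * ρ x =
      -∫ x, χ x * w x * v' x * ρ x := by
    rw [← integral_neg]
    refine integral_congr_ae (Eventually.of_forall fun x => ?_)
    simp only [hF]; rw [hLw' x]; ring
  rw [e0] at hadj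
  -- the product rule and the friction shift, pointwise
  have hprod : ∀ x, P.generator N T T F x =
      χ x * P.generator N T T w x +
      (w x * (P.γ * (deriv smoothCutoff (H x / R) / R * (T + T - x.2 b₀ ^ 2 - x.2 b₁ ^ 2) +
        deriv (deriv smoothCutoff) (H x / R) / R ^ 2 * (T * x.2 b₀ ^ 2 + T * x.2 b₁ ^ 2))) +
        deriv smoothCutoff (H x / R) / R *
          (2 * P.γ * T * x.2 b₀ * partialP b₀ w x + 2 * P.γ * T * x.2 b₁ * partialP b₁ w x)) := by
    intro x
    have h := generator_mul_smoothCutoff_hamiltonian hU2 hV2 hN0 hγT hγT hw2 R x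
    have e1 : (fun y => w y * smoothCutoff (P.hamiltonian N y / R)) = F := by
      funext y; show w y * smoothCutoff (H y / R) = w y * χ y; rw [hχ y]
    rw [e1] at h
    rw [h, ← hχ x]
  have hshift : ∀ x, P.generator N T T w x = -v x + (γ - γ₁) *
      ((T * partialP b₀ (partialP b₀ w) x - x.2 b₀ * partialP b₀ w x) +
        (T * partialP b₁ (partialP b₁ w) x - x.2 b₁ * partialP b₁ w x)) := by
    intro x
    rw [hP, generator_eq_generator_add ω₂ lam β γ γ₁ hN T w x, hLw x]
  -- `∂_b χ = χ'(H/R) p_b / R`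
  have hdχ : ∀ i x, partialP i χ x = deriv smoothCutoff (H x / R) / R * x.2 i := by
    intro i x; rw [hχf]; exact partialP_energyCutoff P N R i x
  -- outside the compact set `{H ≤ 2R}` every cutoff factor vanishes
  have hK : IsCompact {x : PhaseSpace N | H x ≤ 2 * R} := pinnedChain_isCompact_setOf_hamiltonian_le hω hl hβ γ N (2 * R)
  have hout : ∀ x : PhaseSpace N, x ∉ {x : PhaseSpace N | H x ≤ 2 * R} →
      χ x = 0 ∧ deriv smoothCutoff (H x / R) = 0 ∧ deriv (deriv smoothCutoff) (H x / R) = 0 := by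
    intro x hx
    simp only [mem_setOf_eq, not_le] at hx
    have h2 : 2 < H x / R := by rw [lt_div_iff₀ hR]; linarith
    have hnot : H x / R ∉ Icc (1 : ℝ) 2 := fun hm => absurd hm.2 (not_le.2 h2)
    refine ⟨?_, SubdiffusiveBondHeat.deriv_smoothCutoff_eq_zero_of_notMem hnot, ?_⟩
    · rw [hχ x]; exact smoothCutoff_of_two_le h2.le
    · -- `χ'` vanishes identically near `H x / R`, hence so does `χ''`
      have hev : deriv smoothCutoff =ᶠ[𝓝 (H x / R)] fun _ => (0 : ℝ) := by
        filter_upwards [Ioi_mem_nhds h2] with u hu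
        exact SubdiffusiveBondHeat.deriv_smoothCutoff_eq_zero_of_notMem fun hm => absurd hm.2 (not_le.2 hu)
      rw [hev.deriv_eq]; simp
  -- the pieces of `(L_γ F) w' ρ`
  set I1 : PhaseSpace N → ℝ := fun x => χ x * v x * w' x * ρ x with hI1
  set IG : Fin N → PhaseSpace N → ℝ := fun b x =>
    χ x * (T * partialP b (partialP b w) x - x.2 b * partialP b w x) * w' x * ρ x with hIG
  set IM : PhaseSpace N → ℝ := fun x => w x * (γ * (deriv smoothCutoff (H x / R) / R *
      (T + T - x.2 b₀ ^ 2 - x.2 b₁ ^ 2) + deriv (deriv smoothCutoff) (H x / R) / R ^ 2 *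
      (T * x.2 b₀ ^ 2 + T * x.2 b₁ ^ 2))) * w' x * ρ x with hIM
  set ID : Fin N → PhaseSpace N → ℝ := fun b x => partialP b χ x * partialP b w x * w' x * ρ x with hID
  have hpt : ∀ x, P.generator N T T F x * w' x * ρ x =
      -I1 x + (γ - γ₁) * (IG b₀ x + IG b₁ x) + IM x + 2 * γ * T * (ID b₀ x + ID b₁ x) := by
    intro x
    simp only [hI1, hIG, hIM, hID]
    rw [hprod x, hshift x, hdχ b₀ x, hdχ b₁ x, hγ']
    ring
  -- integrability: every piece is continuous and vanishes off `{H ≤ 2R}`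
  have hcs : ∀ f : PhaseSpace N → ℝ, Continuous f → (∀ x, x ∉ {x : PhaseSpace N | H x ≤ 2 * R} → f x = 0) →
      Integrable f := fun f hf h0 => hf.integrable_of_hasCompactSupport (HasCompactSupport.intro hK h0)
  have iI1 : Integrable I1 := hcs I1 (by simp only [hI1]; fun_prop) fun x hx => by
    simp only [hI1, (hout x hx).1]; ring
  have iIG : ∀ b, Integrable (IG b) := fun b => hcs (IG b)
    (by simp only [hIG]; exact (((hχcont.mul ((continuous_const.mul (hPPwc b)).sub ((hpc b).mul (hPwc b)))).mul
      hw'.continuous).mul hρc)) fun x hx => by simp only [hIG, (hout x hx).1]; ring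
  have iIM : Integrable IM := hcs IM (by simp only [hIM]; fun_prop) fun x hx => by
    simp only [hIM, (hout x hx).2.1, (hout x hx).2.2]; ring
  have iID : ∀ b, Integrable (ID b) := fun b => hcs (ID b) (by simp only [hID]; fun_prop) fun x hx => by
    simp only [hID, hdχ b x, (hout x hx).2.1]; ring
  -- integrate the pointwise identity
  have hsplit : ∫ x, P.generator N T T F x * w' x * ρ x =
      -(∫ x, I1 x) + (γ - γ₁) * ((∫ x, IG b₀ x) + ∫ x, IG b₁ x) + (∫ x, IM x) +
        2 * γ * T * ((∫ x, ID b₀ x) + ∫ x, ID b₁ x) := by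
    rw [integral_congr_ae (Eventually.of_forall hpt)]
    rw [integral_add, integral_add, integral_add, integral_neg, integral_const_mul, integral_const_mul,
      integral_add (iIG b₀) (iIG b₁), integral_add (iID b₀) (iID b₁)]
    · exact iI1.neg
    · exact ((iIG b₀).add (iIG b₁)).const_mul _
    · exact iI1.neg.add (((iIG b₀).add (iIG b₁)).const_mul _)
    · exact iIM
    · exact (iI1.neg.add (((iIG b₀).add (iIG b₁)).const_mul _)).add iIM
    · exact ((iID b₀).add (iID b₁)).const_mul _
  -- the bath pieces in first-order form: `∫ χ (G_b w) w' ρ = -T(∫ w' ∂χ ∂w ρ + ∫ χ ∂w' ∂w ρ)`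
  set F' : PhaseSpace N → ℝ := fun y => w' y * χ y with hF'
  have hF'2 : ContDiff ℝ 2 F' := hw'2.mul hχ2
  have hF'c : HasCompactSupport F' := hχc.mul_left
  have hdF' : ∀ b x, partialP b F' x = w' x * partialP b χ x + χ x * partialP b w' x := fun b x => by
    simp only [hF']; exact partialP_mul hw'd hχd b x
  have hG : ∀ b, ∫ x, IG b x = -T * ((∫ x, w' x * partialP b χ x * partialP b w x * ρ x) +
      ∫ x, χ x * partialP b w' x * partialP b w x * ρ x) := by
    intro b
    have hsym := integral_bath_mul_mul_gibbsDensity P hU1 hV1 N T hT.ne' hF'2 hF'c hw2 b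
    have hcar := integral_bath_mul_gibbsDensity_eq_neg P hU1 hV1 N hT.ne' hF'2 hF'c hw1 b
    have e1 : ∫ x, IG b x = ∫ x, F' x * (T * partialP b (partialP b w) x - x.2 b * partialP b w x) * ρ x :=
      integral_congr_ae (Eventually.of_forall fun x => by simp only [hIG, hF']; ring)
    rw [e1, ← hsym, hcar]
    have iA : Integrable fun x => w' x * partialP b χ x * partialP b w x * ρ x :=
      hcs _ (by fun_prop) fun x hx => by simp only [hdχ b x, (hout x hx).2.1]; ring
    have iB : Integrable fun x => χ x * partialP b w' x * partialP b w x * ρ x :=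
      hcs _ (by fun_prop) fun x hx => by simp only [(hout x hx).1]; ring
    rw [← integral_add iA iB]
    congr 1
    exact integral_congr_ae (Eventually.of_forall fun x => by simp only [hdF' b x]; ring)
  -- assemble
  rw [hsplit, hG b₀, hG b₁] at hadj
  simp only [hI1, hIM, hID] at hadj
  linarith

end Pinned

end Pencil

/-! ## Registered helper stub -/

open Pencil in
/-- **Registered sub-goal `stub_pencilOfGreenKubo_frictionShift`** of the crux (this file's ticket): the friction shift of
the generator (= `Pencil.generator_eq_generator_add`, with the `Fin` proofs as explicit binders). [folklore] -/
theorem stub_pencilOfGreenKubo_frictionShift :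
    ∀ (N : ℕ) (ω₂ lam β γ γ₁ : ℝ), 2 ≤ N → ∀ (T : ℝ) (f : Literature.MathematicalPhysics.KineticTheory.HeatConduction.PhaseSpace N → ℝ) (x : Literature.MathematicalPhysics.KineticTheory.HeatConduction.PhaseSpace N), ∀ (h0 : 0 < N) (h1 : N - 1 < N), (Literature.MathematicalPhysics.KineticTheory.HeatConduction.pinnedChain ω₂ lam β γ).generator N T T f x = (Literature.MathematicalPhysics.KineticTheory.HeatConduction.pinnedChain ω₂ lam β γ₁).generator N T T f x + (γ - γ₁) * ((T * Literature.MathematicalPhysics.KineticTheory.HeatConduction.partialP ⟨0, h0⟩ (Literature.MathematicalPhysics.KineticTheory.HeatConduction.partialP ⟨0, h0⟩ f) x - x.2 ⟨0, h0⟩ * Literature.MathematicalPhysics.KineticTheory.HeatConduction.partialP ⟨0, h0⟩ f x) + (T * Literature.MathematicalPhysics.KineticTheory.HeatConduction.partialP ⟨N - 1, h1⟩ (Literature.MathematicalPhysics.KineticTheory.HeatConduction.partialP ⟨N - 1, h1⟩ f) x - x.2 ⟨N - 1, h1⟩ * Literature.MathematicalPhysics.KineticTheory.HeatConduction.partialP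 ⟨N - 1, h1⟩ f x)) :=
  fun _ ω₂ lam β γ γ₁ hN T f x _ _ => generator_eq_generator_add ω₂ lam β γ γ₁ hN T f x

end Summit.AtomisticToContinuum.FouriersLaw.Theorems.ContactStieltjesMeasure.CayleyPencil

end
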